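import Literature.NumberTheory.Sieve.MontgomeryVaughan1975Section6C
import Literature.NumberTheory.Sieve.DivisorBound
import HarnessLib

/-!
# Montgomery–Vaughan (1975), §6: (6.13)–(6.17), the main term completed and (6.17) assembled — PROVED

H. L. Montgomery, R. C. Vaughan, *The exceptional set in Goldbach's problem*, Acta Arith. 27
(1975) 353–370 [MontgomeryVaughanActa1975], §6, p. 363. Fourth layer of the discharge of the named
fact `section6_formulae`; with `Section6A`–`Section6C` this file PROVES its first conjunct,
**(6.17)**: `majorArc_formula_nonexceptional` —
`∃ C δ₀ > 0, ∀ 0 < δ ≤ δ₀, ∃ X₀, ∀ X ≥ X₀, ∀ 1 ≤ n ≤ X,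
 |R₁(n) − 𝔖(n) n| ≤ C (X^{1+δ} P⁻¹ + (n/φ(n)) (W X^{1/2} + W²))` (`P = X^{6δ}`, `Q = X^{1−6δ}`,
`W = errTotal P Q X`). (The second conjunct, (6.1͂7), is the exceptional-character variant.)

The estimates (6.13), (6.14) are obtained in a CRUDE but sufficient explicit form — every loss is a
power of `d(n)`, a `log`, or `P^{o(1)}`, all absorbed by `X^{δ}` through the divisor bound
(`Literature.NumberTheory.Sieve.exists_card_divisors_le_mul_rpow`):

* `abs_ramanujanDivisorSum_le`: `|c_q(n)| ≤ (q,n) d(n)`; `le_totient_mul_card_divisors`: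
  `q ≤ φ(q) d(q)` for squarefree `q`; `abs_goldbachSeriesTerm_le`:
  `|μ(q)² c_q(n)/φ(q)²| ≤ (q,n) d(n) d(q)²/q²`;
* `sum_gcd_mul_le`, `sum_filter_dvd_le`: `∑_q (q,n) f(q) ≤ ∑_{d∣n} d ∑_{d∣q} f(q) ≤ ∑_{d∣n} d ∑_m f(dm)`;
* `exists_tail_abs_goldbachSeriesTerm_le` — **(6.14), Rankin with exponent `11/12`**:
  `∑_{P<q≤M} |μ² c_q(n)/φ²| ≤ K d(n)² P^{−11/12}`; `exists_head_sum_mul_abs_goldbachSeriesTerm_le` —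
  **(6.13)**: `∑_{q≤P} q|μ² c_q(n)/φ²| ≤ K d(n)² P^{1/24}(1 + log P)` (harmonic sum);
* `abs_sum_goldbachSeriesTerm_sub_singularSeries_le` — **(6.16)**: completing to
  `𝔖(n) = ∑_{q≥1} μ(q)² c_q(n)/φ(q)²` (the tree's `hasSum_goldbachSeriesTerm`);
* `norm_sum_majorArcMainTerm_sub_le` — **(6.12)–(6.15)**:
  `|∑_{q≤P} majorArcMainTerm − 𝔖(n)n| ≤ n K₁ d(n)² P^{−11/12} + 4Q K₂ d(n)² P^{1/24}(1+log P)`;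
* `majorArc_mainTerm_eval`: the same as `≤ 2 X^{1+δ} P⁻¹` for `P = X^{6δ}`, `0 < δ ≤ 1/24`,
  `X ≥ X₀(δ)`; `majorArc_formula_nonexceptional`: plus `majorArc_remainder_bound` (Section6B).
-/

noncomputable section

open MeasureTheory Finset Real Complex Classical
open scoped ArithmeticFunction.Moebius FourierTransform

namespace Literature.NumberTheory.Sieve.MontgomeryVaughan1975

/-! ### Crude arithmetic bounds for `μ(q)² c_q(n) φ(q)⁻²` -/

/-- `|c_q(n)| ≤ (q, n) d(n)` (Kluyver: `c_q(n) = ∑_{d ∣ (q,n)} d μ(q/d)`, each `d ≤ (q, n)`, and the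
`d` are divisors of `n`). [folklore] -/
theorem abs_ramanujanDivisorSum_le {n : ℕ} (hn : n ≠ 0) (q : ℕ) :
    |(ramanujanDivisorSum n q : ℝ)| ≤ (Nat.gcd q n : ℝ) * (n.divisors.card : ℝ) := by
  rw [ramanujanDivisorSum_apply]
  push_cast
  refine (Finset.abs_sum_le_sum_abs _ _).trans ?_
  -- each term is at most `[y ∣ n] y ≤ [y ∣ n] (q, n)`
  have hterm : ∀ x ∈ q.divisorsAntidiagonal,
      |((μ x.1 : ℤ) : ℝ) * (if x.2 ∣ n then (x.2 : ℝ) else 0)| ≤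
        if x.2 ∣ n then (Nat.gcd q n : ℝ) else 0 := by
    intro x hx
    rw [Nat.mem_divisorsAntidiagonal] at hx
    have hμ : |((μ x.1 : ℤ) : ℝ)| ≤ 1 := by
      have := ArithmeticFunction.abs_moebius_le_one (n := x.1)
      exact_mod_cast this
    split_ifs with hd
    · rw [abs_mul, Nat.abs_cast]
      have hy : x.2 ∣ Nat.gcd q n := Nat.dvd_gcd (Dvd.intro_left _ hx.1) hd
      have hyle : (x.2 : ℝ) ≤ Nat.gcd q n := by
        exact_mod_cast Nat.le_of_dvd (Nat.gcd_pos_of_pos_right _ (Nat.pos_of_ne_zero hn)) hy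
      calc |((μ x.1 : ℤ) : ℝ)| * (x.2 : ℝ) ≤ 1 * (x.2 : ℝ) :=
            mul_le_mul_of_nonneg_right hμ (Nat.cast_nonneg _)
        _ ≤ _ := by rw [one_mul]; exact hyle
    · simp
  refine (Finset.sum_le_sum hterm).trans ?_
  -- the number of `(x, y)` with `xy = q`, `y ∣ n` is at most `d(n)`
  rw [Nat.sum_divisorsAntidiagonal' (f := fun _ y => if y ∣ n then (Nat.gcd q n : ℝ) else 0),
    ← Finset.sum_filter]
  calc ∑ y ∈ q.divisors.filter (fun y => y ∣ n), (Nat.gcd q n : ℝ)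
      = ((q.divisors.filter (fun y => y ∣ n)).card : ℝ) * Nat.gcd q n := by
        rw [Finset.sum_const, nsmul_eq_mul]
    _ ≤ (n.divisors.card : ℝ) * Nat.gcd q n := by
        gcongr
        intro y hy
        rw [Finset.mem_filter] at hy
        exact Nat.mem_divisors.mpr ⟨hy.2, hn⟩
    _ = _ := mul_comm _ _

/-- For squarefree `q`: `q ≤ φ(q) 2^{ω(q)}` (`p ≤ 2(p−1)` prime by prime). [folklore] -/
theorem le_totient_mul_two_pow {q : ℕ} (hq : Squarefree q) :
    (q : ℝ) ≤ (Nat.totient q : ℝ) * 2 ^ q.primeFactors.card := by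
  have hq0 : q ≠ 0 := hq.ne_zero
  have h1 : (Nat.totient q : ℝ) = ∏ p ∈ q.primeFactors, ((p : ℝ) - 1) := by
    have h := Nat.totient_mul_prod_primeFactors q
    rw [Nat.prod_primeFactors_of_squarefree hq] at h
    have h' : (Nat.totient q : ℝ) * q = q * ∏ p ∈ q.primeFactors, ((p - 1 : ℕ) : ℝ) := by
      exact_mod_cast h
    have hq' : (q : ℝ) ≠ 0 := by exact_mod_cast hq0
    have : (Nat.totient q : ℝ) = ∏ p ∈ q.primeFactors, ((p - 1 : ℕ) : ℝ) := by
      field_simp at h'; linarith [h']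
    rw [this]
    refine Finset.prod_congr rfl fun p hp => ?_
    rw [Nat.cast_sub (Nat.prime_of_mem_primeFactors hp).one_le]; simp
  have h2 : (q : ℝ) = ∏ p ∈ q.primeFactors, (p : ℝ) := by
    rw [← Nat.cast_prod, Nat.prod_primeFactors_of_squarefree hq]
  rw [h1, h2, ← Finset.prod_const, ← Finset.prod_mul_distrib]
  refine Finset.prod_le_prod (fun p _ => Nat.cast_nonneg p) fun p hp => ?_
  have h2p : (2 : ℝ) ≤ p := by exact_mod_cast (Nat.prime_of_mem_primeFactors hp).two_le
  linarith

/-- For squarefree `q`: `q ≤ φ(q) d(q)`. [folklore] -/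
theorem le_totient_mul_card_divisors {q : ℕ} (hq : Squarefree q) :
    (q : ℝ) ≤ (Nat.totient q : ℝ) * (q.divisors.card : ℝ) := by
  refine (le_totient_mul_two_pow hq).trans (mul_le_mul_of_nonneg_left ?_ (Nat.cast_nonneg _))
  exact_mod_cast GoldbachSeries.two_pow_card_primeFactors_le_card_divisors hq.ne_zero

/-- **Pointwise majorant**: `|μ(q)² c_q(n)/φ(q)²| ≤ (q,n) d(n) d(q)² / q²` for `q, n ≥ 1`. [folklore] -/
theorem abs_goldbachSeriesTerm_le {n : ℕ} (hn : n ≠ 0) {q : ℕ} (hq : q ≠ 0) :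
    |goldbachSeriesTerm n q| ≤
      (Nat.gcd q n : ℝ) * (n.divisors.card : ℝ) * (q.divisors.card : ℝ) ^ 2 / (q : ℝ) ^ 2 := by
  by_cases hsq : Squarefree q
  swap
  · rw [goldbachSeriesTerm_eq_zero_of_not_squarefree n hsq, abs_zero]; positivity
  rw [goldbachSeriesTerm_apply, abs_div, abs_mul, abs_pow, abs_pow, Nat.abs_cast]
  have hμ : |(μ q : ℝ)| ^ 2 ≤ 1 := by
    have : |(μ q : ℝ)| ≤ 1 := by exact_mod_cast ArithmeticFunction.abs_moebius_le_one (n := q)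
    calc |(μ q : ℝ)| ^ 2 ≤ 1 ^ 2 := pow_le_pow_left₀ (abs_nonneg _) this 2
      _ = 1 := one_pow 2
  have hφ0 : (0 : ℝ) < Nat.totient q := by exact_mod_cast Nat.totient_pos.mpr (Nat.pos_of_ne_zero hq)
  have hq0 : (0 : ℝ) < q := by exact_mod_cast Nat.pos_of_ne_zero hq
  have hc := abs_ramanujanDivisorSum_le hn q
  have hφ := le_totient_mul_card_divisors hsq
  -- `|μ|² |c| / φ² ≤ (q,n) d(n) / φ² ≤ (q,n) d(n) d(q)²/q²`
  have hcast : |((ramanujanDivisorSum n q : ℤ) : ℝ)| = |(ramanujanDivisorSum n q : ℝ)| := by norm_cast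
  calc |(μ q : ℝ)| ^ 2 * |((ramanujanDivisorSum n q : ℤ) : ℝ)| / (Nat.totient q : ℝ) ^ 2
      ≤ 1 * ((Nat.gcd q n : ℝ) * n.divisors.card) / (Nat.totient q : ℝ) ^ 2 := by
        gcongr
    _ = (Nat.gcd q n : ℝ) * n.divisors.card * (1 / (Nat.totient q : ℝ) ^ 2) := by ring
    _ ≤ (Nat.gcd q n : ℝ) * n.divisors.card * ((q.divisors.card : ℝ) ^ 2 / (q : ℝ) ^ 2) := by
        apply mul_le_mul_of_nonneg_left _ (by positivity)
        rw [div_le_div_iff₀ (by positivity) (by positivity), one_mul]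
        calc (q : ℝ) ^ 2 ≤ ((Nat.totient q : ℝ) * q.divisors.card) ^ 2 :=
              pow_le_pow_left₀ hq0.le hφ 2
          _ = (q.divisors.card : ℝ) ^ 2 * (Nat.totient q : ℝ) ^ 2 := by ring
    _ = _ := by ring

/-! ### Sums against `(q, n)`: `∑_q (q,n) f(q) ≤ ∑_{d ∣ n} d ∑_{d ∣ q} f(q)` -/

/-- `(q, n) ≤ ∑_{d ∣ n, d ∣ q} d`. [folklore] -/
theorem gcd_le_sum_divisors {n : ℕ} (hn : n ≠ 0) (q : ℕ) :
    (Nat.gcd q n : ℝ) ≤ ∑ d ∈ n.divisors.filter (fun d => d ∣ q), (d : ℝ) := by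
  have hmem : Nat.gcd q n ∈ n.divisors.filter (fun d => d ∣ q) := by
    rw [Finset.mem_filter, Nat.mem_divisors]
    exact ⟨⟨Nat.gcd_dvd_right q n, hn⟩, Nat.gcd_dvd_left q n⟩
  exact Finset.single_le_sum (f := fun d : ℕ => (d : ℝ)) (fun d _ => Nat.cast_nonneg d) hmem

/-- **`∑_{q∈S} (q,n) f(q) ≤ ∑_{d ∣ n} d ∑_{q ∈ S, d ∣ q} f(q)`** for `f ≥ 0`. [folklore] -/
theorem sum_gcd_mul_le {n : ℕ} (hn : n ≠ 0) (S : Finset ℕ) {f : ℕ → ℝ} (hf : ∀ q, 0 ≤ f q) :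
    ∑ q ∈ S, (Nat.gcd q n : ℝ) * f q ≤
      ∑ d ∈ n.divisors, (d : ℝ) * ∑ q ∈ S.filter (fun q => d ∣ q), f q := by
  calc ∑ q ∈ S, (Nat.gcd q n : ℝ) * f q
      ≤ ∑ q ∈ S, (∑ d ∈ n.divisors.filter (fun d => d ∣ q), (d : ℝ)) * f q :=
        Finset.sum_le_sum fun q _ => mul_le_mul_of_nonneg_right (gcd_le_sum_divisors hn q) (hf q)
    _ = ∑ q ∈ S, ∑ d ∈ n.divisors, (if d ∣ q then (d : ℝ) * f q else 0) := by
        refine Finset.sum_congr rfl fun q _ => ?_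
        rw [Finset.sum_mul, Finset.sum_filter]
    _ = ∑ d ∈ n.divisors, ∑ q ∈ S, (if d ∣ q then (d : ℝ) * f q else 0) := Finset.sum_comm
    _ = _ := by
        refine Finset.sum_congr rfl fun d _ => ?_
        rw [Finset.mul_sum, Finset.sum_filter]

/-- Multiples of `d ≥ 1` in `[1, M]`, reindexed: `∑_{q≤M, d∣q} f(q) ≤ ∑_{m ≤ M} f(dm)` for `f ≥ 0`.
[folklore] -/
theorem sum_filter_dvd_le {d M : ℕ} (hd : d ≠ 0) {f : ℕ → ℝ} (hf : ∀ q, 0 ≤ f q) (S : Finset ℕ)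
    (hS : S ⊆ Finset.Icc 1 M) :
    ∑ q ∈ S.filter (fun q => d ∣ q), f q ≤ ∑ m ∈ Finset.Icc 1 M, f (d * m) := by
  have hsub : S.filter (fun q => d ∣ q) ⊆ (Finset.Icc 1 M).image (fun m => d * m) := by
    intro q hq
    rw [Finset.mem_filter] at hq
    obtain ⟨m, rfl⟩ := hq.2
    have hqm := Finset.mem_Icc.mp (hS hq.1)
    refine Finset.mem_image.mpr ⟨m, Finset.mem_Icc.mpr ⟨?_, ?_⟩, rfl⟩
    · rcases Nat.eq_zero_or_pos m with h0 | h0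
      · subst h0; simp at hqm
      · exact h0
    · exact le_trans (Nat.le_mul_of_pos_left m (Nat.pos_of_ne_zero hd)) hqm.2
  calc ∑ q ∈ S.filter (fun q => d ∣ q), f q ≤ ∑ q ∈ (Finset.Icc 1 M).image (fun m => d * m), f q :=
        Finset.sum_le_sum_of_subset_of_nonneg hsub fun q _ _ => hf q
    _ = ∑ m ∈ Finset.Icc 1 M, f (d * m) := by
        rw [Finset.sum_image]
        intro a _ b _ h
        exact Nat.eq_of_mul_eq_mul_left (Nat.pos_of_ne_zero hd) h

/-! ### The two sums of `|μ(q)² c_q(n) φ(q)⁻²|`: the tail `q > P` (Rankin) and `∑_{q ≤ P} q(…)` -/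

/-- **The tail, Rankin's trick with exponent `11/12`**:
`∑_{P < q ≤ M} |μ(q)² c_q(n)/φ(q)²| ≤ K d(n)² P^{−11/12}` uniformly in `M`, with an absolute `K`
(crude form of Montgomery–Vaughan's (6.14) `≪ P⁻¹ d(n) n/φ(n)`; exponent `11/12` suffices downstream).
[cite: MontgomeryVaughanActa1975, §6 (6.14)] -/
theorem exists_tail_abs_goldbachSeriesTerm_le :
    ∃ K : ℝ, 0 < K ∧ ∀ n : ℕ, n ≠ 0 → ∀ P : ℝ, 1 ≤ P → ∀ M : ℕ,
      ∑ q ∈ Finset.Ioc ⌊P⌋₊ M, |goldbachSeriesTerm n q| ≤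
        K * (n.divisors.card : ℝ) ^ 2 * P ^ (-(11 / 12 : ℝ)) := by
  obtain ⟨C, hC1, hC⟩ := exists_card_divisors_le_mul_rpow (ε := 1 / 48) (by norm_num)
  set a : ℝ := -(25 / 24 : ℝ) with ha
  have hsum : Summable (fun m : ℕ => (m : ℝ) ^ a) := Real.summable_nat_rpow.mpr (by rw [ha]; norm_num)
  set ζ : ℝ := ∑' m : ℕ, (m : ℝ) ^ a with hζ
  have hζ0 : 0 ≤ ζ := tsum_nonneg fun m => Real.rpow_nonneg (Nat.cast_nonneg m) _
  refine ⟨C ^ 2 * ζ + 1, by positivity, fun n hn P hP M => ?_⟩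
  have hP0 : 0 < P := by linarith
  set s : ℝ := 11 / 12 with hs
  -- pointwise: `|g q| ≤ P^{-s} · d(n) C² · (q,n) q^a` for `q > P`
  have hpt : ∀ q ∈ Finset.Ioc ⌊P⌋₊ M, |goldbachSeriesTerm n q| ≤
      P ^ (-s) * ((n.divisors.card : ℝ) * C ^ 2) * ((Nat.gcd q n : ℝ) * (q : ℝ) ^ a) := by
    intro q hq
    rw [Finset.mem_Ioc] at hq
    have hq0 : q ≠ 0 := by omega
    have hqP : P ≤ q := (Nat.lt_of_floor_lt hq.1).le
    have hq0' : (0 : ℝ) < q := by exact_mod_cast Nat.pos_of_ne_zero hq0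
    have h1 := abs_goldbachSeriesTerm_le hn hq0
    have h2 : (q.divisors.card : ℝ) ≤ C * (q : ℝ) ^ (1 / 48 : ℝ) := hC q hq0
    have h3 : 1 ≤ (q : ℝ) ^ s * P ^ (-s) := by
      rw [Real.rpow_neg hP0.le, ← div_eq_mul_inv, ← Real.div_rpow hq0'.le hP0.le]
      exact Real.one_le_rpow ((one_le_div hP0).mpr hqP) (by rw [hs]; norm_num)
    have hexp : (q : ℝ) ^ s * ((q : ℝ) ^ (1 / 48 : ℝ)) ^ 2 / (q : ℝ) ^ 2 = (q : ℝ) ^ a := by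
      rw [← Real.rpow_natCast ((q : ℝ) ^ (1 / 48 : ℝ)), ← Real.rpow_mul hq0'.le, ← Real.rpow_add hq0',
        ← Real.rpow_natCast (q : ℝ), ← Real.rpow_sub hq0']
      norm_num [ha, hs]
    calc |goldbachSeriesTerm n q| ≤ 1 * |goldbachSeriesTerm n q| := (one_mul _).symm.le
      _ ≤ ((q : ℝ) ^ s * P ^ (-s)) *
            ((Nat.gcd q n : ℝ) * n.divisors.card * (q.divisors.card : ℝ) ^ 2 / (q : ℝ) ^ 2) :=
          mul_le_mul h3 h1 (abs_nonneg _) (by positivity)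
      _ ≤ ((q : ℝ) ^ s * P ^ (-s)) *
            ((Nat.gcd q n : ℝ) * n.divisors.card * (C * (q : ℝ) ^ (1 / 48 : ℝ)) ^ 2 / (q : ℝ) ^ 2) := by
          gcongr
      _ = P ^ (-s) * ((n.divisors.card : ℝ) * C ^ 2) *
            ((Nat.gcd q n : ℝ) * ((q : ℝ) ^ s * ((q : ℝ) ^ (1 / 48 : ℝ)) ^ 2 / (q : ℝ) ^ 2)) := by ring
      _ = _ := by rw [hexp]
  -- sum, regroup by the divisors `d ∣ n`, reindex the multiples
  have hS : Finset.Ioc ⌊P⌋₊ M ⊆ Finset.Icc 1 M := by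
    intro q hq; rw [Finset.mem_Ioc] at hq; rw [Finset.mem_Icc]; omega
  have hinner : ∀ d ∈ n.divisors,
      ∑ q ∈ (Finset.Ioc ⌊P⌋₊ M).filter (fun q => d ∣ q), (q : ℝ) ^ a ≤ (d : ℝ) ^ a * ζ := by
    intro d hd
    have hd0 : d ≠ 0 := Nat.ne_of_gt (Nat.pos_of_mem_divisors hd)
    calc ∑ q ∈ (Finset.Ioc ⌊P⌋₊ M).filter (fun q => d ∣ q), (q : ℝ) ^ a
        ≤ ∑ m ∈ Finset.Icc 1 M, ((d * m : ℕ) : ℝ) ^ a :=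
          sum_filter_dvd_le hd0 (fun q => Real.rpow_nonneg (Nat.cast_nonneg q) _) _ hS
      _ = (d : ℝ) ^ a * ∑ m ∈ Finset.Icc 1 M, (m : ℝ) ^ a := by
          rw [Finset.mul_sum]
          refine Finset.sum_congr rfl fun m _ => ?_
          push_cast
          exact Real.mul_rpow (Nat.cast_nonneg d) (Nat.cast_nonneg m)
      _ ≤ (d : ℝ) ^ a * ζ :=
          mul_le_mul_of_nonneg_left (hsum.sum_le_tsum _ fun m _ => Real.rpow_nonneg (Nat.cast_nonneg m) _)
            (Real.rpow_nonneg (Nat.cast_nonneg d) _)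
  have hdiv : ∀ d ∈ n.divisors, (d : ℝ) * ((d : ℝ) ^ a * ζ) ≤ ζ := by
    intro d hd
    have hd1 : (1 : ℝ) ≤ d := by exact_mod_cast Nat.pos_of_mem_divisors hd
    have hd0 : (d : ℝ) ≠ 0 := by linarith
    have : (d : ℝ) * (d : ℝ) ^ a = (d : ℝ) ^ (a + 1) := by rw [Real.rpow_add_one hd0]; ring
    rw [← mul_assoc, this]
    have h1 : (d : ℝ) ^ (a + 1) ≤ 1 := Real.rpow_le_one_of_one_le_of_nonpos hd1 (by rw [ha]; norm_num)
    calc (d : ℝ) ^ (a + 1) * ζ ≤ 1 * ζ := mul_le_mul_of_nonneg_right h1 hζ0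
      _ = ζ := one_mul ζ
  have hdn0 : (0 : ℝ) ≤ n.divisors.card := Nat.cast_nonneg _
  calc ∑ q ∈ Finset.Ioc ⌊P⌋₊ M, |goldbachSeriesTerm n q|
      ≤ ∑ q ∈ Finset.Ioc ⌊P⌋₊ M, P ^ (-s) * ((n.divisors.card : ℝ) * C ^ 2) *
          ((Nat.gcd q n : ℝ) * (q : ℝ) ^ a) := Finset.sum_le_sum hpt
    _ = P ^ (-s) * ((n.divisors.card : ℝ) * C ^ 2) *
          ∑ q ∈ Finset.Ioc ⌊P⌋₊ M, (Nat.gcd q n : ℝ) * (q : ℝ) ^ a := by rw [Finset.mul_sum]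
    _ ≤ P ^ (-s) * ((n.divisors.card : ℝ) * C ^ 2) *
          ∑ d ∈ n.divisors, (d : ℝ) * ∑ q ∈ (Finset.Ioc ⌊P⌋₊ M).filter (fun q => d ∣ q), (q : ℝ) ^ a := by
        apply mul_le_mul_of_nonneg_left _ (by positivity)
        exact sum_gcd_mul_le hn _ fun q => Real.rpow_nonneg (Nat.cast_nonneg q) _
    _ ≤ P ^ (-s) * ((n.divisors.card : ℝ) * C ^ 2) * ∑ d ∈ n.divisors, ζ := by
        apply mul_le_mul_of_nonneg_left _ (by positivity)
        refine Finset.sum_le_sum fun d hd => ?_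
        exact (mul_le_mul_of_nonneg_left (hinner d hd) (Nat.cast_nonneg d)).trans (hdiv d hd)
    _ = C ^ 2 * ζ * (n.divisors.card : ℝ) ^ 2 * P ^ (-s) := by
        rw [Finset.sum_const, nsmul_eq_mul]; ring
    _ ≤ (C ^ 2 * ζ + 1) * (n.divisors.card : ℝ) ^ 2 * P ^ (-(11 / 12 : ℝ)) := by
        rw [hs]
        have : 0 ≤ (n.divisors.card : ℝ) ^ 2 * P ^ (-(11 / 12 : ℝ)) := by positivity
        nlinarith

/-- **The sum `∑_{q ≤ P} q |μ(q)² c_q(n)/φ(q)²| ≤ K d(n)² P^{1/24} (1 + log P)`** with an absolute `K`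
(crude form of Montgomery–Vaughan's (6.13) `≪ d(n) (n/φ(n)) log P`). [cite: MontgomeryVaughanActa1975, §6 (6.13)] -/
theorem exists_head_sum_mul_abs_goldbachSeriesTerm_le :
    ∃ K : ℝ, 0 < K ∧ ∀ n : ℕ, n ≠ 0 → ∀ P : ℝ, 1 ≤ P →
      ∑ q ∈ Finset.Icc 1 ⌊P⌋₊, (q : ℝ) * |goldbachSeriesTerm n q| ≤
        K * (n.divisors.card : ℝ) ^ 2 * P ^ (1 / 24 : ℝ) * (1 + Real.log P) := by
  obtain ⟨C, hC1, hC⟩ := exists_card_divisors_le_mul_rpow (ε := 1 / 48) (by norm_num)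
  refine ⟨C ^ 2, by positivity, fun n hn P hP => ?_⟩
  have hP0 : 0 < P := by linarith
  set N := ⌊P⌋₊ with hN
  have hNP : (N : ℝ) ≤ P := Nat.floor_le hP0.le
  -- pointwise: `q |g q| ≤ d(n) C² P^{1/24} · (q,n) q⁻¹` for `1 ≤ q ≤ P`
  have hpt : ∀ q ∈ Finset.Icc 1 N, (q : ℝ) * |goldbachSeriesTerm n q| ≤
      ((n.divisors.card : ℝ) * C ^ 2 * P ^ (1 / 24 : ℝ)) * ((Nat.gcd q n : ℝ) * (q : ℝ)⁻¹) := by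
    intro q hq
    rw [Finset.mem_Icc] at hq
    have hq0 : q ≠ 0 := by omega
    have hq0' : (0 : ℝ) < q := by exact_mod_cast Nat.pos_of_ne_zero hq0
    have hqP : (q : ℝ) ≤ P := le_trans (by exact_mod_cast hq.2) hNP
    have h1 := abs_goldbachSeriesTerm_le hn hq0
    have h2 : (q.divisors.card : ℝ) ≤ C * (q : ℝ) ^ (1 / 48 : ℝ) := hC q hq0
    have h4 : ((q : ℝ) ^ (1 / 48 : ℝ)) ^ 2 ≤ P ^ (1 / 24 : ℝ) := by
      rw [← Real.rpow_natCast, ← Real.rpow_mul hq0'.le]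
      norm_num
      exact Real.rpow_le_rpow hq0'.le hqP (by norm_num)
    calc (q : ℝ) * |goldbachSeriesTerm n q|
        ≤ (q : ℝ) * ((Nat.gcd q n : ℝ) * n.divisors.card * (q.divisors.card : ℝ) ^ 2 / (q : ℝ) ^ 2) :=
          mul_le_mul_of_nonneg_left h1 hq0'.le
      _ ≤ (q : ℝ) * ((Nat.gcd q n : ℝ) * n.divisors.card * (C * (q : ℝ) ^ (1 / 48 : ℝ)) ^ 2 / (q : ℝ) ^ 2) := by
          gcongr
      _ = ((n.divisors.card : ℝ) * C ^ 2 * ((q : ℝ) ^ (1 / 48 : ℝ)) ^ 2) * ((Nat.gcd q n : ℝ) * (q : ℝ)⁻¹) := by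
          field_simp
      _ ≤ _ := by gcongr
  -- sum over `q`, regroup, harmonic sum
  have hinner : ∀ d ∈ n.divisors,
      ∑ q ∈ (Finset.Icc 1 N).filter (fun q => d ∣ q), (q : ℝ)⁻¹ ≤ (d : ℝ)⁻¹ * (1 + Real.log P) := by
    intro d hd
    have hd0 : d ≠ 0 := Nat.ne_of_gt (Nat.pos_of_mem_divisors hd)
    have hd0' : (0 : ℝ) < d := by exact_mod_cast Nat.pos_of_mem_divisors hd
    calc ∑ q ∈ (Finset.Icc 1 N).filter (fun q => d ∣ q), (q : ℝ)⁻¹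
        ≤ ∑ m ∈ Finset.Icc 1 N, ((d * m : ℕ) : ℝ)⁻¹ :=
          sum_filter_dvd_le hd0 (fun q => inv_nonneg.mpr (Nat.cast_nonneg q)) _ le_rfl
      _ = (d : ℝ)⁻¹ * ∑ m ∈ Finset.Icc 1 N, (m : ℝ)⁻¹ := by
          rw [Finset.mul_sum]
          refine Finset.sum_congr rfl fun m _ => ?_
          push_cast
          rw [mul_inv]
      _ ≤ (d : ℝ)⁻¹ * (1 + Real.log P) := by
          apply mul_le_mul_of_nonneg_left _ (inv_nonneg.mpr hd0'.le)
          have hh : (∑ m ∈ Finset.Icc 1 N, (m : ℝ)⁻¹) = ((harmonic N : ℚ) : ℝ) := by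
            rw [harmonic_eq_sum_Icc]; push_cast; rfl
          rw [hh]
          refine (harmonic_le_one_add_log N).trans ?_
          rcases Nat.eq_zero_or_pos N with h0 | hpos
          · rw [h0]; simp; exact Real.log_nonneg hP
          · have : Real.log N ≤ Real.log P := Real.log_le_log (by exact_mod_cast hpos) hNP
            linarith
  calc ∑ q ∈ Finset.Icc 1 N, (q : ℝ) * |goldbachSeriesTerm n q|
      ≤ ∑ q ∈ Finset.Icc 1 N, ((n.divisors.card : ℝ) * C ^ 2 * P ^ (1 / 24 : ℝ)) *
          ((Nat.gcd q n : ℝ) * (q : ℝ)⁻¹) := Finset.sum_le_sum hpt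
    _ = ((n.divisors.card : ℝ) * C ^ 2 * P ^ (1 / 24 : ℝ)) *
          ∑ q ∈ Finset.Icc 1 N, (Nat.gcd q n : ℝ) * (q : ℝ)⁻¹ := by rw [Finset.mul_sum]
    _ ≤ ((n.divisors.card : ℝ) * C ^ 2 * P ^ (1 / 24 : ℝ)) *
          ∑ d ∈ n.divisors, (d : ℝ) * ∑ q ∈ (Finset.Icc 1 N).filter (fun q => d ∣ q), (q : ℝ)⁻¹ := by
        apply mul_le_mul_of_nonneg_left _ (by positivity)
        exact sum_gcd_mul_le hn _ fun q => inv_nonneg.mpr (Nat.cast_nonneg q)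
    _ ≤ ((n.divisors.card : ℝ) * C ^ 2 * P ^ (1 / 24 : ℝ)) * ∑ d ∈ n.divisors, (1 + Real.log P) := by
        apply mul_le_mul_of_nonneg_left _ (by positivity)
        refine Finset.sum_le_sum fun d hd => ?_
        have hd0' : (0 : ℝ) < d := by exact_mod_cast Nat.pos_of_mem_divisors hd
        calc (d : ℝ) * ∑ q ∈ (Finset.Icc 1 N).filter (fun q => d ∣ q), (q : ℝ)⁻¹
            ≤ (d : ℝ) * ((d : ℝ)⁻¹ * (1 + Real.log P)) := mul_le_mul_of_nonneg_left (hinner d hd) hd0'.le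
          _ = 1 + Real.log P := by field_simp
    _ = C ^ 2 * (n.divisors.card : ℝ) ^ 2 * P ^ (1 / 24 : ℝ) * (1 + Real.log P) := by
        rw [Finset.sum_const, nsmul_eq_mul]; ring

/-! ### (6.12)–(6.16): the main term is `𝔖(n) n + O(…)` -/

/-- **Completing the singular series (6.14) + (6.16)**: for `n ≥ 1`, `P ≥ 1`,
`|∑_{q ≤ ⌊P⌋} μ(q)² c_q(n)/φ(q)² − 𝔖(n)| ≤ K d(n)² P^{−11/12}` with the constant of
`exists_tail_abs_goldbachSeriesTerm_le` (`𝔖(n) = ∑_{q≥1} μ(q)² c_q(n)/φ(q)²` is the tree's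
`hasSum_goldbachSeriesTerm`). [cite: MontgomeryVaughanActa1975, §6 (6.16)] -/
theorem abs_sum_goldbachSeriesTerm_sub_singularSeries_le {K : ℝ}
    (hK : ∀ n : ℕ, n ≠ 0 → ∀ P : ℝ, 1 ≤ P → ∀ M : ℕ,
      ∑ q ∈ Finset.Ioc ⌊P⌋₊ M, |goldbachSeriesTerm n q| ≤ K * (n.divisors.card : ℝ) ^ 2 * P ^ (-(11 / 12 : ℝ)))
    {n : ℕ} (hn : n ≠ 0) {P : ℝ} (hP : 1 ≤ P) :
    |∑ q ∈ Finset.Icc 1 ⌊P⌋₊, goldbachSeriesTerm n q - goldbachSingularSeries n| ≤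
      K * (n.divisors.card : ℝ) ^ 2 * P ^ (-(11 / 12 : ℝ)) := by
  set N := ⌊P⌋₊ with hN
  set g : ℕ → ℝ := fun q => goldbachSeriesTerm n q with hg
  have hg0 : g 0 = 0 := by simp [hg, goldbachSeriesTerm_apply]
  have hIcc : ∑ q ∈ Finset.Icc 1 N, g q = ∑ q ∈ Finset.range (N + 1), g q := by
    rw [Finset.range_eq_Ico, show Finset.Icc 1 N = Finset.Ico 1 (N + 1) by
      ext q; simp only [Finset.mem_Icc, Finset.mem_Ico]; omega]
    rw [Finset.sum_eq_sum_Ico_succ_bot (Nat.succ_pos N), hg0, zero_add]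
  have hlim := (hasSum_goldbachSeriesTerm hn).tendsto_sum_nat
  -- the tails `∑_{N < q ≤ M} g` converge to `𝔖 − ∑_{q ≤ N} g`
  have htail : Filter.Tendsto (fun M : ℕ => ∑ q ∈ Finset.Ioc N M, g q) Filter.atTop
      (nhds (goldbachSingularSeries n - ∑ q ∈ Finset.Icc 1 N, g q)) := by
    have h1 : Filter.Tendsto (fun M : ℕ => ∑ q ∈ Finset.range (M + 1), g q - ∑ q ∈ Finset.range (N + 1), g q)
        Filter.atTop (nhds (goldbachSingularSeries n - ∑ q ∈ Finset.Icc 1 N, g q)) := by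
      rw [hIcc]
      exact (hlim.comp (Filter.tendsto_add_atTop_nat 1)).sub_const _
    refine h1.congr' ?_
    filter_upwards [Filter.eventually_ge_atTop N] with M hM
    rw [← Finset.sum_Ico_eq_sub _ (by omega : N + 1 ≤ M + 1)]
    congr 1
    ext q; simp only [Finset.mem_Ico, Finset.mem_Ioc]; omega
  have habs := (continuous_abs.tendsto _).comp htail
  have hbound : ∀ M : ℕ, |∑ q ∈ Finset.Ioc N M, g q| ≤ K * (n.divisors.card : ℝ) ^ 2 * P ^ (-(11 / 12 : ℝ)) :=
    fun M => (Finset.abs_sum_le_sum_abs _ _).trans (hK n hn P hP M)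
  have := le_of_tendsto' habs fun M => hbound M
  rwa [abs_sub_comm] at this

/-- `2P + 1 + qQ/2 ≤ 2qQ` for `q ≥ 1`, `Q ≥ 2`, `2P < Q`. [folklore] -/
theorem window_error_le {P Q : ℝ} {q : ℕ} (hq : 1 ≤ q) (hQ : 2 ≤ Q) (hPQ : 2 * P < Q) :
    2 * P + 1 + 1 / (2 * (1 / (q * Q))) ≤ 2 * (q * Q) := by
  have hq1 : (1 : ℝ) ≤ q := by exact_mod_cast hq
  have hqQ : Q ≤ q * Q := by nlinarith
  rw [show 1 / (2 * (1 / ((q : ℝ) * Q))) = q * Q / 2 by field_simp]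
  nlinarith

/-- **The main term evaluated** (Montgomery–Vaughan 1975, (6.12)–(6.16) in crude explicit form): for
`P ≥ 1`, `Q ≥ 2`, `2P < Q`, `1 ≤ n ≤ X`,
`|∑_{q≤P} majorArcMainTerm − 𝔖(n) n| ≤ n K₁ d(n)² P^{−11/12} + 4Q K₂ d(n)² P^{1/24}(1 + log P)`.
[cite: MontgomeryVaughanActa1975, §6 (6.15)] -/
theorem norm_sum_majorArcMainTerm_sub_le {K₁ K₂ : ℝ}
    (hK₁ : ∀ n : ℕ, n ≠ 0 → ∀ P : ℝ, 1 ≤ P → ∀ M : ℕ,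
      ∑ q ∈ Finset.Ioc ⌊P⌋₊ M, |goldbachSeriesTerm n q| ≤ K₁ * (n.divisors.card : ℝ) ^ 2 * P ^ (-(11 / 12 : ℝ)))
    (hK₂ : ∀ n : ℕ, n ≠ 0 → ∀ P : ℝ, 1 ≤ P →
      ∑ q ∈ Finset.Icc 1 ⌊P⌋₊, (q : ℝ) * |goldbachSeriesTerm n q| ≤
        K₂ * (n.divisors.card : ℝ) ^ 2 * P ^ (1 / 24 : ℝ) * (1 + Real.log P))
    {P Q X : ℝ} (hP : 1 ≤ P) (hQ : 2 ≤ Q) (hPQ : 2 * P < Q) {n : ℕ} (hn : 1 ≤ n) (hnX : (n : ℝ) ≤ X) :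
    ‖∑ q ∈ Finset.Icc 1 ⌊P⌋₊, majorArcMainTerm P Q X n q - ((goldbachSingularSeries n * n : ℝ) : ℂ)‖ ≤
      (n : ℝ) * (K₁ * (n.divisors.card : ℝ) ^ 2 * P ^ (-(11 / 12 : ℝ))) +
        4 * Q * (K₂ * (n.divisors.card : ℝ) ^ 2 * P ^ (1 / 24 : ℝ) * (1 + Real.log P)) := by
  have hn0 : n ≠ 0 := by omega
  have hP0 : 0 ≤ P := by linarith
  set N := ⌊P⌋₊ with hN
  set g : ℕ → ℝ := fun q => goldbachSeriesTerm n q with hg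
  set J : ℕ → ℂ := fun q => ∫ η in (-(1 / (q * Q)))..(1 / (q * Q)),
    linSum P X η * linSum P X η * (𝐞 (-(n * η)) : ℂ) with hJ
  -- `∑ M_q = ∑ g(q) J_q = n ∑ g + ∑ g (J − n)`
  have h1 : ∑ q ∈ Finset.Icc 1 N, majorArcMainTerm P Q X n q =
      ((∑ q ∈ Finset.Icc 1 N, g q : ℝ) : ℂ) * n + ∑ q ∈ Finset.Icc 1 N, (g q : ℂ) * (J q - n) := by
    push_cast
    rw [Finset.sum_mul, ← Finset.sum_add_distrib]
    refine Finset.sum_congr rfl fun q hq => ?_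
    rw [Finset.mem_Icc] at hq
    rw [majorArcMainTerm_eq (by omega)]
    simp only [hg, hJ]; ring
  have hJb : ∀ q ∈ Finset.Icc 1 N, ‖J q - n‖ ≤ 2 * (q * Q) := by
    intro q hq
    rw [Finset.mem_Icc] at hq
    have hq0 : (0 : ℝ) < q := by exact_mod_cast hq.1
    have hh : 0 < 1 / ((q : ℝ) * Q) := by positivity
    have hh2 : 1 / ((q : ℝ) * Q) ≤ 1 / 2 := by
      apply one_div_le_one_div_of_le (by norm_num)
      have : (1 : ℝ) ≤ q := by exact_mod_cast hq.1
      nlinarith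
    exact (norm_integral_linSum_sq_sub_le hP0 hh hh2 hnX).trans (window_error_le hq.1 hQ hPQ)
  rw [h1]
  have hsplit : ((∑ q ∈ Finset.Icc 1 N, g q : ℝ) : ℂ) * n + ∑ q ∈ Finset.Icc 1 N, (g q : ℂ) * (J q - n) -
      ((goldbachSingularSeries n * n : ℝ) : ℂ) =
      (((∑ q ∈ Finset.Icc 1 N, g q - goldbachSingularSeries n : ℝ) : ℂ) * n) +
        ∑ q ∈ Finset.Icc 1 N, (g q : ℂ) * (J q - n) := by push_cast; ring
  rw [hsplit]
  refine (norm_add_le _ _).trans (add_le_add ?_ ?_)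
  · -- the completed singular series
    rw [norm_mul, Complex.norm_natCast, Complex.norm_real, Real.norm_eq_abs, mul_comm]
    exact mul_le_mul_of_nonneg_left (abs_sum_goldbachSeriesTerm_sub_singularSeries_le hK₁ hn0 hP)
      (Nat.cast_nonneg n)
  · -- the `J_q − n` errors
    calc ‖∑ q ∈ Finset.Icc 1 N, (g q : ℂ) * (J q - n)‖
        ≤ ∑ q ∈ Finset.Icc 1 N, |g q| * (2 * (q * Q)) := by
          refine (norm_sum_le _ _).trans (Finset.sum_le_sum fun q hq => ?_)
          rw [norm_mul, Complex.norm_real, Real.norm_eq_abs]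
          exact mul_le_mul_of_nonneg_left (hJb q hq) (abs_nonneg _)
      _ = 2 * Q * ∑ q ∈ Finset.Icc 1 N, (q : ℝ) * |g q| := by
          rw [Finset.mul_sum]; exact Finset.sum_congr rfl fun q _ => by ring
      _ ≤ 2 * Q * (K₂ * (n.divisors.card : ℝ) ^ 2 * P ^ (1 / 24 : ℝ) * (1 + Real.log P)) :=
          mul_le_mul_of_nonneg_left (hK₂ n hn0 P hP) (by linarith)
      _ ≤ 4 * Q * (K₂ * (n.divisors.card : ℝ) ^ 2 * P ^ (1 / 24 : ℝ) * (1 + Real.log P)) := by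
          have h0 : 0 ≤ K₂ * (n.divisors.card : ℝ) ^ 2 * P ^ (1 / 24 : ℝ) * (1 + Real.log P) := by
            have := hK₂ n hn0 P hP
            exact le_trans (Finset.sum_nonneg fun q _ => by positivity) this
          nlinarith

/-! ### The main term in the form used by (6.17): `O(X^{1+δ} P⁻¹)` with `P = X^{6δ}` -/

/-- Thresholds for the main-term estimate, given `δ > 0` and constants `A, B ≥ 0`: eventually in `X`,
`X ≥ 1`, `X^{1−6δ} ≥ 2`, `2X^{6δ} < X^{1−6δ}` (needs `δ < 1/12`), `A ≤ X^{δ/4}` and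
`B (1 + 6δ log X) ≤ X^{δ/2}`. [folklore] -/
theorem eventually_mainTerm_thresholds {δ A B : ℝ} (hδ : 0 < δ) (hδ' : δ ≤ 1 / 24) (hB : 0 ≤ B) :
    ∀ᶠ X : ℝ in Filter.atTop, 1 ≤ X ∧ 2 ≤ X ^ (1 - 6 * δ) ∧ 2 * X ^ (6 * δ) < X ^ (1 - 6 * δ) ∧
      A ≤ X ^ (δ / 4) ∧ B * (1 + 6 * δ * Real.log X) ≤ X ^ (δ / 2) := by
  have h1 : ∀ᶠ X : ℝ in Filter.atTop, 1 ≤ X := Filter.eventually_ge_atTop 1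
  have h2 : ∀ᶠ X : ℝ in Filter.atTop, 2 ≤ X ^ (1 - 6 * δ) :=
    (tendsto_rpow_atTop (by linarith)).eventually_ge_atTop 2
  have h3 : ∀ᶠ X : ℝ in Filter.atTop, 2 < X ^ (1 - 12 * δ) :=
    (tendsto_rpow_atTop (by linarith)).eventually_gt_atTop 2
  have h4 : ∀ᶠ X : ℝ in Filter.atTop, A ≤ X ^ (δ / 4) :=
    (tendsto_rpow_atTop (by linarith)).eventually_ge_atTop A
  have h5 : ∀ᶠ X : ℝ in Filter.atTop, B * (1 + 6 * δ) ≤ X ^ (δ / 4) :=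
    (tendsto_rpow_atTop (by linarith)).eventually_ge_atTop _
  have h6 : ∀ᶠ X : ℝ in Filter.atTop, ‖Real.log X‖ ≤ 1 * ‖X ^ (δ / 4)‖ :=
    (isLittleO_log_rpow_atTop (by linarith : 0 < δ / 4)).bound (by norm_num)
  filter_upwards [h1, h2, h3, h4, h5, h6] with X a b c d e f
  have hX0 : 0 < X := by linarith
  refine ⟨a, b, ?_, d, ?_⟩
  · have : X ^ (1 - 6 * δ) = X ^ (6 * δ) * X ^ (1 - 12 * δ) := by
      rw [← Real.rpow_add hX0]; ring_nf
    rw [this]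
    have hp : 0 < X ^ (6 * δ) := Real.rpow_pos_of_pos hX0 _
    nlinarith
  · have hlog : Real.log X ≤ X ^ (δ / 4) := by
      have hl0 : 0 ≤ Real.log X := Real.log_nonneg a
      rw [Real.norm_eq_abs, Real.norm_eq_abs, abs_of_nonneg hl0, one_mul,
        abs_of_nonneg (Real.rpow_nonneg hX0.le _)] at f
      exact f
    have hq1 : 1 ≤ X ^ (δ / 4) := Real.one_le_rpow a (by linarith)
    have hsq : X ^ (δ / 4) * X ^ (δ / 4) = X ^ (δ / 2) := by rw [← Real.rpow_add hX0]; ring_nf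
    calc B * (1 + 6 * δ * Real.log X) ≤ B * (1 + 6 * δ * X ^ (δ / 4)) := by gcongr
      _ ≤ B * (1 + 6 * δ) * X ^ (δ / 4) := by nlinarith [mul_nonneg hB hδ.le]
      _ ≤ X ^ (δ / 4) * X ^ (δ / 4) := mul_le_mul_of_nonneg_right e (by linarith)
      _ = X ^ (δ / 2) := hsq

/-- Exponent bookkeeping for the main-term estimate. [folklore] -/
theorem rpow_bookkeeping {X δ : ℝ} (hX : 0 < X) :
    X ^ (δ / 4) * (X * X ^ (δ / 4) * X ^ (-(11 / 2 * δ))) = X ^ (1 - 5 * δ) ∧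
    X ^ (δ / 2) * (X ^ (1 - 6 * δ) * X ^ (δ / 4) * X ^ (δ / 4)) = X ^ (1 - 5 * δ) ∧
    X ^ (1 + δ) * (X ^ (6 * δ))⁻¹ = X ^ (1 - 5 * δ) := by
  have hX' : X ≠ 0 := hX.ne'
  refine ⟨?_, ?_, ?_⟩
  · have : X * X ^ (δ / 4) = X ^ (δ / 4 + 1) := by rw [Real.rpow_add_one hX']; ring
    rw [this, ← Real.rpow_add hX, ← Real.rpow_add hX]; ring_nf
  · rw [← Real.rpow_add hX, ← Real.rpow_add hX, ← Real.rpow_add hX]; ring_nf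
  · rw [← Real.rpow_neg hX.le, ← Real.rpow_add hX]; ring_nf

/-- **The main terms summed: `∑_{q≤P} majorArcMainTerm = 𝔖(n) n + O(X^{1+δ} P⁻¹)`**
(Montgomery–Vaughan 1975, (6.15): "the first term on the right of (6.4), summed over `q ≤ P`, is
`𝔖(n)n + O(X^{1+δ}P⁻¹)`"), with `P = X^{6δ}`, `Q = X^{1−6δ}`, an absolute constant (`C = 2`),
`0 < δ ≤ 1/24`, `X ≥ X₀(δ)` and `1 ≤ n ≤ X` (the divisor bound `d(n) ≪ n^{δ/8}` and `log X ≪ X^{δ/4}`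
absorb the crude factors of the tail lemmas). [cite: MontgomeryVaughanActa1975, §6 (6.15)] -/
theorem majorArc_mainTerm_eval :
    ∃ C : ℝ, 0 < C ∧ ∃ δ₀ : ℝ, 0 < δ₀ ∧ ∀ δ : ℝ, 0 < δ → δ ≤ δ₀ → ∃ X₀ : ℝ, ∀ X : ℝ, X₀ ≤ X →
      (2 ≤ X ^ (1 - 6 * δ) ∧ 2 * X ^ (6 * δ) < X ^ (1 - 6 * δ)) ∧
      ∀ n : ℕ, 1 ≤ n → (n : ℝ) ≤ X →
        ‖∑ q ∈ Finset.Icc 1 ⌊X ^ (6 * δ)⌋₊, majorArcMainTerm (X ^ (6 * δ)) (X ^ (1 - 6 * δ)) X n q -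
            ((goldbachSingularSeries n * n : ℝ) : ℂ)‖ ≤
          C * (X ^ (1 + δ) * (X ^ (6 * δ))⁻¹) := by
  obtain ⟨K₁, hK₁0, hK₁⟩ := exists_tail_abs_goldbachSeriesTerm_le
  obtain ⟨K₂, hK₂0, hK₂⟩ := exists_head_sum_mul_abs_goldbachSeriesTerm_le
  refine ⟨2, two_pos, 1 / 24, by norm_num, fun δ hδ hδ' => ?_⟩
  obtain ⟨Cd, hCd1, hCd⟩ := exists_card_divisors_le_mul_rpow (ε := δ / 8) (by linarith)
  obtain ⟨X₀, hX₀⟩ := Filter.eventually_atTop.mp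
    (eventually_mainTerm_thresholds (A := K₁ * Cd ^ 2) (B := 4 * K₂ * Cd ^ 2) hδ hδ' (by positivity))
  refine ⟨X₀, fun X hX => ?_⟩
  obtain ⟨hX1, hQ2, hPQ, hA, hB⟩ := hX₀ X hX
  refine ⟨⟨hQ2, hPQ⟩, fun n hn hnX => ?_⟩
  have hX0 : 0 < X := by linarith
  set P : ℝ := X ^ (6 * δ) with hP
  set Q : ℝ := X ^ (1 - 6 * δ) with hQ
  have hP1 : 1 ≤ P := Real.one_le_rpow hX1 (by linarith)
  have hn0 : n ≠ 0 := by omega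
  refine (norm_sum_majorArcMainTerm_sub_le hK₁ hK₂ hP1 hQ2 hPQ hn hnX).trans ?_
  obtain ⟨e1, e2, e3⟩ := rpow_bookkeeping (δ := δ) hX0
  -- `d(n)² ≤ Cd² X^{δ/4}`
  have hd : (n.divisors.card : ℝ) ^ 2 ≤ Cd ^ 2 * X ^ (δ / 4) := by
    have h1 : (n.divisors.card : ℝ) ≤ Cd * (n : ℝ) ^ (δ / 8) := hCd n hn0
    have h2 : (n : ℝ) ^ (δ / 8) ≤ X ^ (δ / 8) := Real.rpow_le_rpow (Nat.cast_nonneg n) hnX (by linarith)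
    calc (n.divisors.card : ℝ) ^ 2 ≤ (Cd * X ^ (δ / 8)) ^ 2 := by
          apply pow_le_pow_left₀ (Nat.cast_nonneg _)
          exact h1.trans (mul_le_mul_of_nonneg_left h2 (by linarith))
      _ = Cd ^ 2 * (X ^ (δ / 8) * X ^ (δ / 8)) := by ring
      _ = Cd ^ 2 * X ^ (δ / 4) := by rw [← Real.rpow_add hX0]; ring_nf
  have hPs : P ^ (-(11 / 12 : ℝ)) = X ^ (-(11 / 2 * δ)) := by
    rw [hP, ← Real.rpow_mul hX0.le]; ring_nf
  have hP24 : P ^ (1 / 24 : ℝ) = X ^ (δ / 4) := by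
    rw [hP, ← Real.rpow_mul hX0.le]; ring_nf
  have hlogP : Real.log P = 6 * δ * Real.log X := by rw [hP, Real.log_rpow hX0]
  have hlog0 : 0 ≤ 1 + 6 * δ * Real.log X := by
    have := Real.log_nonneg hX1; positivity
  rw [e3]
  -- term 1
  have ht1 : (n : ℝ) * (K₁ * (n.divisors.card : ℝ) ^ 2 * P ^ (-(11 / 12 : ℝ))) ≤ X ^ (1 - 5 * δ) := by
    rw [hPs]
    have hpos : 0 ≤ X ^ (-(11 / 2 * δ)) := Real.rpow_nonneg hX0.le _
    calc (n : ℝ) * (K₁ * (n.divisors.card : ℝ) ^ 2 * X ^ (-(11 / 2 * δ)))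
        ≤ X * (K₁ * (Cd ^ 2 * X ^ (δ / 4)) * X ^ (-(11 / 2 * δ))) := by gcongr
      _ = (K₁ * Cd ^ 2) * (X * X ^ (δ / 4) * X ^ (-(11 / 2 * δ))) := by ring
      _ ≤ X ^ (δ / 4) * (X * X ^ (δ / 4) * X ^ (-(11 / 2 * δ))) :=
          mul_le_mul_of_nonneg_right hA (by positivity)
      _ = X ^ (1 - 5 * δ) := e1
  -- term 2
  have ht2 : 4 * Q * (K₂ * (n.divisors.card : ℝ) ^ 2 * P ^ (1 / 24 : ℝ) * (1 + Real.log P)) ≤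
      X ^ (1 - 5 * δ) := by
    rw [hP24, hlogP]
    have hQ0 : 0 ≤ Q := by rw [hQ]; exact Real.rpow_nonneg hX0.le _
    calc 4 * Q * (K₂ * (n.divisors.card : ℝ) ^ 2 * X ^ (δ / 4) * (1 + 6 * δ * Real.log X))
        ≤ 4 * Q * (K₂ * (Cd ^ 2 * X ^ (δ / 4)) * X ^ (δ / 4) * (1 + 6 * δ * Real.log X)) := by gcongr
      _ = (4 * K₂ * Cd ^ 2 * (1 + 6 * δ * Real.log X)) * (Q * X ^ (δ / 4) * X ^ (δ / 4)) := by ring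
      _ ≤ X ^ (δ / 2) * (Q * X ^ (δ / 4) * X ^ (δ / 4)) :=
          mul_le_mul_of_nonneg_right hB (by positivity)
      _ = X ^ (1 - 5 * δ) := by rw [hQ]; exact e2
  linarith

/-! ### (6.17): the non-exceptional major-arc formula -/

/-- **(6.17) of Montgomery–Vaughan 1975** — the first conjunct of the named fact `section6_formulae`:
there are absolute `C, δ₀ > 0` such that for `0 < δ ≤ δ₀`, `X ≥ X₀(δ)`, `P = X^{6δ}`,
`Q = X^{1−6δ}` and every `1 ≤ n ≤ X`,
`|R₁(n) − 𝔖(n) n| ≤ C (X^{1+δ} P⁻¹ + (n/φ(n)) (W X^{1/2} + W²))`, `W = errTotal P Q X`.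
PROVED: `Section6A` (6.1)–(6.4), `Section6B` (6.5)–(6.8), `Section6C` and this file (6.10)–(6.16).
[cite: MontgomeryVaughanActa1975, §6 (6.17)] -/
theorem majorArc_formula_nonexceptional :
    ∃ C : ℝ, 0 < C ∧ ∃ δ₀ : ℝ, 0 < δ₀ ∧ ∀ δ : ℝ, 0 < δ → δ ≤ δ₀ → ∃ X₀ : ℝ, ∀ X : ℝ, X₀ ≤ X →
      ∀ n : ℕ, 1 ≤ n → (n : ℝ) ≤ X →
        ‖majorArcIntegral (X ^ (6 * δ)) (X ^ (1 - 6 * δ)) X n -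
            ((goldbachSingularSeries n * n : ℝ) : ℂ)‖ ≤
          C * (X ^ (1 + δ) * (X ^ (6 * δ))⁻¹ +
            (n : ℝ) / (Nat.totient n : ℝ) *
              (errTotal (X ^ (6 * δ)) (X ^ (1 - 6 * δ)) X * X ^ (1 / 2 : ℝ) +
                errTotal (X ^ (6 * δ)) (X ^ (1 - 6 * δ)) X ^ 2)) := by
  obtain ⟨C, hC, δ₀, hδ₀, H⟩ := majorArc_mainTerm_eval
  refine ⟨max C (8 * Real.exp 2), lt_max_of_lt_left hC, min δ₀ 1, lt_min hδ₀ one_pos, fun δ hδ hδle => ?_⟩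
  obtain ⟨X₀, hX₀⟩ := H δ hδ (hδle.trans (min_le_left _ _))
  refine ⟨max X₀ 1, fun X hX n hn hnX => ?_⟩
  obtain ⟨⟨hQ2, hPQ⟩, hmain⟩ := hX₀ X ((le_max_left _ _).trans hX)
  have hX1 : 1 ≤ X := (le_max_right _ _).trans hX
  have hX0 : 0 ≤ X := by linarith
  have hP0 : 0 ≤ X ^ (6 * δ) := Real.rpow_nonneg hX0 _
  have hn0 : n ≠ 0 := by omega
  have hrem := majorArc_remainder_bound (P := X ^ (6 * δ)) (Q := X ^ (1 - 6 * δ)) hX0 hP0 hQ2 hPQ hn0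
  have hmt := hmain n hn hnX
  set W := errTotal (X ^ (6 * δ)) (X ^ (1 - 6 * δ)) X with hW
  set M := ∑ q ∈ Finset.Icc 1 ⌊X ^ (6 * δ)⌋₊, majorArcMainTerm (X ^ (6 * δ)) (X ^ (1 - 6 * δ)) X n q
    with hM
  have hW0 : 0 ≤ W := errTotal_nonneg _ _ _
  have ht0 : 0 ≤ (n : ℝ) / (Nat.totient n : ℝ) := by positivity
  have hE0 : 0 ≤ X ^ (1 + δ) * (X ^ (6 * δ))⁻¹ := by positivity
  have hX2 : 0 ≤ X ^ (1 / 2 : ℝ) := Real.rpow_nonneg hX0 _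
  calc ‖majorArcIntegral (X ^ (6 * δ)) (X ^ (1 - 6 * δ)) X n - ((goldbachSingularSeries n * n : ℝ) : ℂ)‖
      = ‖(majorArcIntegral (X ^ (6 * δ)) (X ^ (1 - 6 * δ)) X n - M) +
          (M - ((goldbachSingularSeries n * n : ℝ) : ℂ))‖ := by congr 1; ring
    _ ≤ ‖majorArcIntegral (X ^ (6 * δ)) (X ^ (1 - 6 * δ)) X n - M‖ +
          ‖M - ((goldbachSingularSeries n * n : ℝ) : ℂ)‖ := norm_add_le _ _
    _ ≤ 4 * Real.exp 2 * ((n : ℝ) / (Nat.totient n : ℝ)) * (2 * X ^ (1 / 2 : ℝ) * W + W ^ 2) +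
          C * (X ^ (1 + δ) * (X ^ (6 * δ))⁻¹) := add_le_add hrem hmt
    _ ≤ max C (8 * Real.exp 2) * (X ^ (1 + δ) * (X ^ (6 * δ))⁻¹ +
          (n : ℝ) / (Nat.totient n : ℝ) * (W * X ^ (1 / 2 : ℝ) + W ^ 2)) := by
        have h1 : C ≤ max C (8 * Real.exp 2) := le_max_left _ _
        have h2 : 8 * Real.exp 2 ≤ max C (8 * Real.exp 2) := le_max_right _ _
        have h3 : 4 * Real.exp 2 * ((n : ℝ) / (Nat.totient n : ℝ)) * (2 * X ^ (1 / 2 : ℝ) * W + W ^ 2) ≤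
            8 * Real.exp 2 * ((n : ℝ) / (Nat.totient n : ℝ) * (W * X ^ (1 / 2 : ℝ) + W ^ 2)) := by
          have : 0 ≤ Real.exp 2 := (Real.exp_pos 2).le
          nlinarith [mul_nonneg ht0 (mul_nonneg hW0 hX2), mul_nonneg ht0 (sq_nonneg W),
            mul_nonneg this (mul_nonneg ht0 (sq_nonneg W))]
        have h4 : 8 * Real.exp 2 * ((n : ℝ) / (Nat.totient n : ℝ) * (W * X ^ (1 / 2 : ℝ) + W ^ 2)) ≤
            max C (8 * Real.exp 2) * ((n : ℝ) / (Nat.totient n : ℝ) * (W * X ^ (1 / 2 : ℝ) + W ^ 2)) :=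
          mul_le_mul_of_nonneg_right h2 (by positivity)
        have h5 : C * (X ^ (1 + δ) * (X ^ (6 * δ))⁻¹) ≤ max C (8 * Real.exp 2) * (X ^ (1 + δ) * (X ^ (6 * δ))⁻¹) :=
          mul_le_mul_of_nonneg_right h1 hE0
        nlinarith

end Literature.NumberTheory.Sieve.MontgomeryVaughan1975
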